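import Mathlib
import Summits.Ventures.PercRepro2.Defs
import Summits.Ventures.PercRepro2.Graph
import Summits.Ventures.PercRepro2.OneColourSwitch
import Summits.Ventures.PercRepro2.RegionHubSign
import Summits.Ventures.PercRepro2.SideSwitch
import Summits.Ventures.PercRepro2.TermSwitchDefs
import Summits.Ventures.PercRepro2.TermSwitchReach
import Summits.Ventures.PercRepro2.M9NoPocketDefs
import Summits.Ventures.PercRepro2.M9Unreached
import Summits.Ventures.PercRepro2.M9GeneralDSplit
import Summits.Ventures.PercRepro2.M9GeneralDHD
import Summits.Ventures.PercRepro2.M9ReachedSum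
import Summits.Ventures.PercRepro2.M9FourParts
import Summits.Ventures.PercRepro2.M9LinkedHD

/-!
# The `K`-reached half of the single-`d` sum (blind cell PercRepro2, p3 g31, 2026-08-28;
`proofs/P3-PAYMENT.md` §3)

`reachedKSum = Σ_{Sep ∧ DOne ∧ d ∈ K₂} σ_pq σ_rs` — the colourings in which `d` is joined to
`{r, s}` in colour `Y` (one-sided or doubly reached).  With the one-sided `K`-part
`kOnlySum` (`d ∈ K₂ ∖ M₂`) and its mirror `mOnlySum`: `dSignSum = N + kOnly + mOnly + EX`
(`dSignSum_eq_four_status`), `reachedKSum = kOnly + EX`, `mOnly = kOnly` (the colour flip), and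
`kOnly + mOnly = reachedOneSum ≤ 0` (REACH, `M9ReachedSum`).  Hence
`dSignSum = N + reachedKSum + kOnly` and **the general single-`d` statement follows from
`reachedKSum ≤ 0`** (`dSignSum_nonpos_of_reachedK_nonpos`) — the conjecture (TFK)/(RK) of
`P3-PAYMENT.md` (census-true graph-level and per type-free `(G−d)`-representative).  Own work;
std axioms.
-/

namespace Summit.Ventures.PercRepro2

namespace NoPocket

open Finset Classical RegionHub OneColourSwitch SideSwitch TermSwitch

variable {V : Type*} {E : Type*}

section Defs

variable [Fintype E] [DecidableEq E] {ends : E → Sym2 V} {p q r s d : V}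

/-- The `K`-reached sum: `Σ_{Sep ∧ DOne ∧ d ∈ K₂} σ_pq σ_rs`. -/
noncomputable def reachedKSum (ends : E → Sym2 V) (p q r s d : V) : ℤ :=
  ∑ ω : Config E, if sep2 ends p q r s ω ∧ DOne ends r s d ω ∧ d ∈ K2 ends r s ω then
    sigma ends ω p q * sigma ends ω r s else 0

/-- The `M`-reached sum: `Σ_{Sep ∧ DOne ∧ d ∈ M₂} σ_pq σ_rs`. -/
noncomputable def reachedMSum (ends : E → Sym2 V) (p q r s d : V) : ℤ :=
  ∑ ω : Config E, if sep2 ends p q r s ω ∧ DOne ends r s d ω ∧ d ∈ M2 ends r s ω then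
    sigma ends ω p q * sigma ends ω r s else 0

/-- The one-sided `K`-part: `Σ_{Sep ∧ DOne ∧ d ∈ K₂ ∖ M₂} σ_pq σ_rs`. -/
noncomputable def kOnlySum (ends : E → Sym2 V) (p q r s d : V) : ℤ :=
  ∑ ω : Config E, if sep2 ends p q r s ω ∧ DOne ends r s d ω ∧
      (d ∈ K2 ends r s ω ∧ d ∉ M2 ends r s ω) then
    sigma ends ω p q * sigma ends ω r s else 0

/-- The one-sided `M`-part: `Σ_{Sep ∧ DOne ∧ d ∈ M₂ ∖ K₂} σ_pq σ_rs`. -/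
noncomputable def mOnlySum (ends : E → Sym2 V) (p q r s d : V) : ℤ :=
  ∑ ω : Config E, if sep2 ends p q r s ω ∧ DOne ends r s d ω ∧
      (d ∈ M2 ends r s ω ∧ d ∉ K2 ends r s ω) then
    sigma ends ω p q * sigma ends ω r s else 0

end Defs

section Identities

variable [Fintype E] [DecidableEq E] {ends : E → Sym2 V} {p q r s d : V}

omit [Fintype E] [DecidableEq E] in
/-- Pointwise: the `K`-reached term is the one-sided `K`-term plus the doubly-reached term. -/
lemma reachedK_term_split (ω : Config E) :
    (if sep2 ends p q r s ω ∧ DOne ends r s d ω ∧ d ∈ K2 ends r s ω then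
        sigma ends ω p q * sigma ends ω r s else 0) =
      (if sep2 ends p q r s ω ∧ DOne ends r s d ω ∧ (d ∈ K2 ends r s ω ∧ d ∉ M2 ends r s ω)
        then sigma ends ω p q * sigma ends ω r s else 0) +
      (if sep2 ends p q r s ω ∧ DOne ends r s d ω ∧ (d ∈ K2 ends r s ω ∧ d ∈ M2 ends r s ω)
        then sigma ends ω p q * sigma ends ω r s else 0) := by
  by_cases h0 : sep2 ends p q r s ω ∧ DOne ends r s d ω
  · by_cases hK : d ∈ K2 ends r s ω
    · by_cases hM : d ∈ M2 ends r s ω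
      · rw [if_pos ⟨h0.1, h0.2, hK⟩, if_neg (fun h => h.2.2.2 hM), if_pos ⟨h0.1, h0.2, hK, hM⟩,
          zero_add]
      · rw [if_pos ⟨h0.1, h0.2, hK⟩, if_pos ⟨h0.1, h0.2, hK, hM⟩, if_neg (fun h => hM h.2.2.2),
          add_zero]
    · rw [if_neg (fun h => hK h.2.2), if_neg (fun h => hK h.2.2.1), if_neg (fun h => hK h.2.2.1),
        add_zero]
  · rw [if_neg (fun h => h0 ⟨h.1, h.2.1⟩), if_neg (fun h => h0 ⟨h.1, h.2.1⟩),
      if_neg (fun h => h0 ⟨h.1, h.2.1⟩), add_zero]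

/-- **`reachedKSum = kOnlySum + exSum`.** -/
theorem reachedKSum_eq_kOnly_add_ex :
    reachedKSum ends p q r s d = kOnlySum ends p q r s d + exSum ends p q r s d := by
  unfold reachedKSum kOnlySum exSum
  rw [← Finset.sum_add_distrib]
  exact Finset.sum_congr rfl fun ω _ => reachedK_term_split ω

omit [Fintype E] [DecidableEq E] in
/-- Pointwise: the one-sided term is the one-sided `K`-term plus the one-sided `M`-term. -/
lemma oneSided_term_split (ω : Config E) :
    (if sep2 ends p q r s ω ∧ DOne ends r s d ω ∧ OneSided ends r s d ω then
        sigma ends ω p q * sigma ends ω r s else 0) =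
      (if sep2 ends p q r s ω ∧ DOne ends r s d ω ∧ (d ∈ K2 ends r s ω ∧ d ∉ M2 ends r s ω)
        then sigma ends ω p q * sigma ends ω r s else 0) +
      (if sep2 ends p q r s ω ∧ DOne ends r s d ω ∧ (d ∈ M2 ends r s ω ∧ d ∉ K2 ends r s ω)
        then sigma ends ω p q * sigma ends ω r s else 0) := by
  by_cases h0 : sep2 ends p q r s ω ∧ DOne ends r s d ω
  · by_cases hK : d ∈ K2 ends r s ω
    · by_cases hM : d ∈ M2 ends r s ω
      · rw [if_neg (fun h => h.2.2.2 ⟨hK, hM⟩), if_neg (fun h => h.2.2.2 hM),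
          if_neg (fun h => h.2.2.2 hK), add_zero]
      · rw [if_pos ⟨h0.1, h0.2, Or.inl hK, fun h => hM h.2⟩, if_pos ⟨h0.1, h0.2, hK, hM⟩,
          if_neg (fun h => hM h.2.2.1), add_zero]
    · by_cases hM : d ∈ M2 ends r s ω
      · rw [if_pos ⟨h0.1, h0.2, Or.inr hM, fun h => hK h.1⟩, if_neg (fun h => hK h.2.2.1),
          if_pos ⟨h0.1, h0.2, hM, hK⟩, zero_add]
      · rw [if_neg (fun h => h.2.2.1.elim hK hM), if_neg (fun h => hK h.2.2.1),
          if_neg (fun h => hM h.2.2.1), add_zero]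
  · rw [if_neg (fun h => h0 ⟨h.1, h.2.1⟩), if_neg (fun h => h0 ⟨h.1, h.2.1⟩),
      if_neg (fun h => h0 ⟨h.1, h.2.1⟩), add_zero]

/-- **`reachedOneSum = kOnlySum + mOnlySum`.** -/
theorem reachedOneSum_eq_kOnly_add_mOnly :
    reachedOneSum ends p q r s d = kOnlySum ends p q r s d + mOnlySum ends p q r s d := by
  unfold reachedOneSum kOnlySum mOnlySum
  rw [← Finset.sum_add_distrib]
  exact Finset.sum_congr rfl fun ω _ => oneSided_term_split ω

/-- **The colour flip: `mOnlySum = kOnlySum`.** -/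
theorem mOnlySum_eq_kOnlySum : mOnlySum ends p q r s d = kOnlySum ends p q r s d := by
  unfold mOnlySum kOnlySum
  refine Fintype.sum_equiv complPerm _ _ (fun ω => ?_)
  simp only [complPerm, Function.Involutive.coe_toPerm]
  rw [sep2_compl, K2_compl, M2_compl, sigma_compl_eq_neg, sigma_compl_eq_neg, neg_mul_neg]
  by_cases h : DOne ends r s d ω
  · have h' : DOne ends r s d (OneColourSwitch.compl ω) := DOne_compl h
    simp only [h, h', true_and]
  · have h' : ¬ DOne ends r s d (OneColourSwitch.compl ω) := fun h'' => by
      have := DOne_compl h''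
      rw [OneColourSwitch.compl_compl] at this
      exact h this
    simp only [h, h', false_and, and_false, if_false]

/-- **The colour flip: `reachedMSum = reachedKSum`.** -/
theorem reachedMSum_eq_reachedKSum : reachedMSum ends p q r s d = reachedKSum ends p q r s d := by
  unfold reachedMSum reachedKSum
  refine Fintype.sum_equiv complPerm _ _ (fun ω => ?_)
  simp only [complPerm, Function.Involutive.coe_toPerm]
  rw [sep2_compl, K2_compl, sigma_compl_eq_neg, sigma_compl_eq_neg, neg_mul_neg]
  by_cases h : DOne ends r s d ω
  · have h' : DOne ends r s d (OneColourSwitch.compl ω) := DOne_compl h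
    simp only [h, h', true_and]
  · have h' : ¬ DOne ends r s d (OneColourSwitch.compl ω) := fun h'' => by
      have := DOne_compl h''
      rw [OneColourSwitch.compl_compl] at this
      exact h this
    simp only [h, h', false_and, and_false, if_false]

/-- **The four statuses: `dSignSum = N + kOnly + mOnly + EX`.** -/
theorem dSignSum_eq_four_status :
    dSignSum ends p q r s d = unreachedSum ends p q r s d + kOnlySum ends p q r s d +
      mOnlySum ends p q r s d + exSum ends p q r s d := by
  rw [dSignSum_eq_dzeroOne_add_ex, dzeroOneSum_eq_add, reachedOneSum_eq_kOnly_add_mOnly]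
  ring

/-- **`dSignSum = N + reachedKSum + kOnlySum`.** -/
theorem dSignSum_eq_unreached_add_reachedK_add_kOnly :
    dSignSum ends p q r s d = unreachedSum ends p q r s d + reachedKSum ends p q r s d +
      kOnlySum ends p q r s d := by
  rw [dSignSum_eq_four_status, reachedKSum_eq_kOnly_add_ex, mOnlySum_eq_kOnlySum]
  ring

end Identities

section Reduction

variable [Fintype V] [DecidableEq V] [Fintype E] [DecidableEq E] {ends : E → Sym2 V}
  {p q r s d : V}

/-- **The one-sided `K`-part is non-positive** (half of REACH). -/
theorem kOnlySum_nonpos (hr : d ≠ r) (hs : d ≠ s) : kOnlySum ends p q r s d ≤ 0 := by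
  have h := reachedOneSum_nonpos (ends := ends) (p := p) (q := q) hr hs
  rw [reachedOneSum_eq_kOnly_add_mOnly, mOnlySum_eq_kOnlySum] at h
  linarith

/-- **The general single-`d` statement follows from `reachedKSum ≤ 0`** (conjecture (RK) of
`proofs/P3-PAYMENT.md`): `dSignSum = N + reachedKSum + kOnlySum` with `N ≤ 0` and
`kOnlySum ≤ 0`. -/
theorem dSignSum_nonpos_of_reachedK_nonpos (hr : d ≠ r) (hs : d ≠ s)
    (h : reachedKSum ends p q r s d ≤ 0) : dSignSum ends p q r s d ≤ 0 := by
  rw [dSignSum_eq_unreached_add_reachedK_add_kOnly]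
  have h1 := unreachedSum_nonpos (ends := ends) (p := p) (q := q) (r := r) (s := s) (d := d)
  have h2 := kOnlySum_nonpos (ends := ends) (p := p) (q := q) hr hs
  linarith

omit [Fintype V] [DecidableEq V] in
/-- **`reachedKSum ≤ 0` is equivalent to `kOnlySum + exSum ≤ 0`**, i.e. to the bound
`exSum ≤ −kOnlySum` on the doubly-reached part by the one-sided `K`-part (the weaker cousin of
⟦EXHD⟧ `exSum + hdSum ≤ 0`). -/
theorem reachedKSum_nonpos_iff :
    reachedKSum ends p q r s d ≤ 0 ↔ kOnlySum ends p q r s d + exSum ends p q r s d ≤ 0 := by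
  rw [reachedKSum_eq_kOnly_add_ex]

end Reduction

end NoPocket

end Summit.Ventures.PercRepro2
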